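import Literature.NumberTheory.GaloisCohomology.Howard2004.CasselsTateTowerZModPairingOneKernelProofs
import Literature.NumberTheory.GaloisCohomology.Howard2004.CasselsTateSkewPairingOfTowerZModPairingProofs
import Literature.NumberTheory.GaloisCohomology.Howard2004.CasselsTateSkewPairingEngineDecompositionsProofs
import Literature.NumberTheory.GaloisCohomology.Howard2004.LevelDecompositionsOfRefineProofs
import Literature.NumberTheory.GaloisCohomology.Howard2004.CasselsTateSkewPairingPrintIntended
import HarnessLib

/-!
# Howard 2004: the print-as-intended leaf C45.1″ `prop141_casselsTate_skewPairing_atLevel_printIntended` from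
# `ℤ/p`-valued LEFT-KERNEL tower pairings on FULL settings alone (the port's single target type) — proofs file

Topic `NumberTheory/GaloisCohomology/Howard2004`. THEOREMS ONLY: no definition, no named fact, no instance, no notation,
no `sorry`.  Cell `pub/bsd-print-x9` (seat `bsd-line-x10b-p1` LEAD g14, brick «C451-CL Q7a ASSEMBLY TARGET»,
`--supports stmt-BirchSwinnertonDyer-22642`).

WHAT IS PROVED.
* §1 **`DVRSetting.hasLevelDecompositionsAt_of_towerZModLeftKernelPairings`** — on ONE FULL `DVRSetting` (`e_i = i + 1`)
  with H.0–H.5: if for every `(k, n ∈ 𝓝^{(k)}, t + 1 < e_k)` there is a bi-additive `R`-BALANCED pairing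
  `Q : H¹_{𝓕(n)}(K, T^{(t)}) × H¹_{𝓕(n)}(K, T^{(0)}) → ℤ/p` (the engine's `selmerModuleAt`) whose LEFT kernel is
  `range H¹(red_{t+1→t})`, which kills `range H¹(red_{t+1→0})` on the right (the ONE-SIDED inclusion only) and satisfies the
  skew identity `Q a (red^t b) = - Q b (red^t a)`, then `S.HasLevelDecompositionsAt hy` (Howard's Thm. 1.4.2 for every
  `(T^{(k)}, 𝓕(n))`): the right kernel is automatic (`towerZModPairing_hright_of_hleft`, x10b-p1-w8), the `ℤ/p`-read entry
  (`skewPairings_display_of_towerZModPairing`, x10b-p1-w7) gives the five clauses of the leaf at `(k, n, t)`, and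
  `hasLevelDecompositionsAt_of_skewPairings_display` the decompositions.
* §2 **`prop141_casselsTate_skewPairing_atLevel_printIntended_of_forall_full_towerZModLeftKernelPairings`** — THE TARGET
  TYPE OF THE CLASS-LEVEL PORT: if every FULL setting with H.0–H.5 admits such pairings UNDER THE TWO PRINTED GUARDS
  `(p : R) ≠ 0`, `p ∤ #𝓞_K^×`, then the leaf C45.1″ holds for EVERY setting — refine an arbitrary setting to a full one
  (`S.refine hy pins`, same `p`, `K`, `R`, so the guards pass through), descend the decompositions
  (`hasLevelDecompositionsAt_of_refine`) and read the five clauses (`skewPairings_display_of_hasLevelDecompositionsAt`).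
  Twin: `…_of_forall_full_hasLevelDecompositionsAt_guarded` (decompositions under the guards ⇒ C45.1″).

So a kernel construction, per full setting under the two guards, of `Q` with (balance, hleft, hright ⊆, skew) — the cell's
bricks Q1–Q6 (global lift from `Ш²(K, T̄) = 0`, the class-level pairing `∑_v ⟨m_v, y_v⟩_v` of local defects, its left kernel
by `TowerSelmerLiftGlobalDualityProofs`, the H.4 dual slot, the one-sided right inclusion, the skew identity) — closes the leaf
C45.1″ BY NAME through §2.

HONEST FRAMING: `Q` is a HYPOTHESIS here; no pairing is constructed; Prop. 1.4.1, Thm. 1.4.2, C45.1′/C45.1″ and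
`thm161_dvrKolyvaginBound` are NOT proved; no summit statement is proved; the Birch–Swinnerton-Dyer conjecture is not proved by
any of this.

References: [Howard2004HeegnerKolyvagin] B. Howard, Compositio Math. **140** (2004) = arXiv:1202.6340, Prop. 1.4.1, Thm. 1.4.2 (proof,
displays (i)(ii)) (p0008 L83–L142), §1.6 ¶1 with Rem. 1.3.1 (p0011 L33–44, p0007 L125–127), Lemma 1.5.1 (p0009 L127–133);
[Flach1990] Thm. 1; [MorganSmith2021CTP] A. Morgan, A. Smith, arXiv:2103.08530, Thm. 1.3, Prop. 3.5, Rem. 6.3.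
-/

set_option autoImplicit false

noncomputable section

namespace Literature.NumberTheory.GaloisCohomology.Howard2004

open Function NumberField IsDedekindDomain Field
open scoped NumberField ContRepresentation
open Literature.NumberTheory.GaloisRepresentations
open Literature.NumberTheory.GaloisRepresentations.DiscreteGaloisModule

namespace DVRSetting

variable {p : ℕ} [Fact p.Prime] {K : Type} [Field K] [NumberField K]
  {R : Type} [CommRing R] [IsDomain R] [IsDiscreteValuationRing R] [Algebra ℤ_[p] R]
  {N : ℕ → Type} [∀ k, AddCommGroup (N k)] [∀ k, TopologicalSpace (N k)]
  [∀ k, DiscreteTopology (N k)] [∀ k, Module R (N k)]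
  {Rk : ℕ → Type} [∀ k, CommRing (Rk k)] [∀ k, IsLocalRing (Rk k)] [∀ k, TopologicalSpace (Rk k)]
  [∀ k, DiscreteTopology (Rk k)] [∀ k, Algebra ℤ_[p] (Rk k)] [∀ k, Algebra R (Rk k)]
  [∀ k, Module (Rk k) (N k)] [∀ k, IsScalarTower R (Rk k) (N k)]
  {Nbar : Type} [AddCommGroup Nbar] [TopologicalSpace Nbar] [DiscreteTopology Nbar]
  [∀ k, Module (Rk k) Nbar]
  {Nq : ℕ → Finset (HeightOneSpectrum (𝓞 K)) → Type} [∀ k n, AddCommGroup (Nq k n)]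
  [∀ k n, TopologicalSpace (Nq k n)] [∀ k n, DiscreteTopology (Nq k n)]
  [∀ k n, Module (Rk k) (Nq k n)] [∀ k n, Module R (Nq k n)]
  [∀ k n, IsScalarTower R (Rk k) (Nq k n)]

/-! ## §1 One full setting: decompositions from left-kernel `ℤ/p`-pairings -/

/-- **Thm. 1.4.2 for every `(T^{(k)}, 𝓕(n))` of ONE FULL setting from `ℤ/p`-valued LEFT-KERNEL tower pairings.**  On a full
`DVRSetting` (`e_i = i + 1`) with H.0–H.5, suppose that for every `(k, n ∈ 𝓝^{(k)}, t + 1 < e_k)` there is a bi-additive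
`R`-balanced `Q : H¹_{𝓕(n)}(K, T^{(t)}) × H¹_{𝓕(n)}(K, T^{(0)}) → ℤ/p` with LEFT kernel `= range H¹(red_{t+1→t})`, killing
`range H¹(red_{t+1→0})` on the right, and skew (`Q a (red^t b) = - Q b (red^t a)`).  Then `S.HasLevelDecompositionsAt hy`:
right kernel by `towerZModPairing_hright_of_hleft`, the five clauses by `skewPairings_display_of_towerZModPairing`, the
decompositions by `hasLevelDecompositionsAt_of_skewPairings_display`.
[cite: Howard2004HeegnerKolyvagin, Prop. 1.4.1 and Thm. 1.4.2 (proof, displays (i)(ii)), §1.6 ¶1 (arXiv:1202.6340 p0008 L83–L142, p0011 L33–44)]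
[cite: MorganSmith2021CTP, Thm. 1.3 and Rem. 6.3] -/
theorem hasLevelDecompositionsAt_of_towerZModLeftKernelPairings (S : DVRSetting p K R N Rk Nbar Nq) (hy : S.SatisfiesH)
    (hfull : ∀ i, S.e i = i + 1)
    (h : ∀ (k : ℕ) (n : Finset (HeightOneSpectrum (𝓞 K))), ↑n ⊆ S.levelPrimes k → ∀ (t : ℕ), t + 1 < S.e k →
      ∃ Q : ↥(S.selmerModuleAt hy t n) →+ ↥(S.selmerModuleAt hy 0 n) →+ ZMod p,
        (letI := galoisCohomology.moduleH1 (S.T.ρ t) (S.T.hlin t);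
          letI := galoisCohomology.moduleH1 (S.T.ρ 0) (S.T.hlin 0);
          ∀ (r : R) (a : ↥(S.selmerModuleAt hy t n)) (w : ↥(S.selmerModuleAt hy 0 n)), Q (r • a) w = Q a (r • w)) ∧
        (letI := galoisCohomology.moduleH1 (S.T.ρ t) (S.T.hlin t);
          letI := galoisCohomology.moduleH1 (S.T.ρ (t + 1)) (S.T.hlin (t + 1));
          ∀ a : ↥(S.selmerModuleAt hy t n), (∀ w, Q a w = 0) ↔
            a ∈ LinearMap.range (S.redSelLE hy (Nat.le_succ t) n)) ∧
        (letI := galoisCohomology.moduleH1 (S.T.ρ 0) (S.T.hlin 0);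
          letI := galoisCohomology.moduleH1 (S.T.ρ (t + 1)) (S.T.hlin (t + 1));
          ∀ (z : ↥(S.selmerModuleAt hy (t + 1) n)) (a : ↥(S.selmerModuleAt hy t n)),
            Q a (S.redSelLE hy (Nat.zero_le (t + 1)) n z) = 0) ∧
        (letI := galoisCohomology.moduleH1 (S.T.ρ t) (S.T.hlin t);
          letI := galoisCohomology.moduleH1 (S.T.ρ 0) (S.T.hlin 0);
          ∀ a b : ↥(S.selmerModuleAt hy t n),
            Q a (S.redSelLE hy (Nat.zero_le t) n b) = - Q b (S.redSelLE hy (Nat.zero_le t) n a))) :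
    S.HasLevelDecompositionsAt hy := by
  refine S.hasLevelDecompositionsAt_of_skewPairings_display hy fun k n hn t ht ↦ ?_
  obtain ⟨Q, hQ, hleft, hright_le, hskew⟩ := h k n hn t ht
  have hright := S.towerZModPairing_hright_of_hleft hy hfull k n hn t ht Q hleft hright_le
  exact S.skewPairings_display_of_towerZModPairing hy hfull k n hn t ht Q hQ hleft hright hskew

end DVRSetting

/-! ## §2 Every setting: the leaf C45.1″ by refinement to a full setting -/

/-- **C45.1″ from decompositions on FULL settings UNDER THE TWO GUARDS.**  If every full `DVRSetting` (`e_i = i + 1`) with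
H.0–H.5, `(p : R) ≠ 0` and `p ∤ #𝓞_K^×` has `HasLevelDecompositionsAt`, then the print-as-intended leaf
`prop141_casselsTate_skewPairing_atLevel_printIntended` holds: an arbitrary setting with the guards refines to a full one with
the SAME `p`, `K`, `R` (so the guards pass through: `S.refine hy pins`, `refine_satisfiesH`), the decompositions descend
(`hasLevelDecompositionsAt_of_refine`), and the five clauses at `(k, n, t)` are read off
(`skewPairings_display_of_hasLevelDecompositionsAt`).  The guarded twin of
`prop141_casselsTate_skewPairing_atLevel_of_forall_full_hasLevelDecompositionsAt`.
[cite: Howard2004HeegnerKolyvagin, Prop. 1.4.1, Thm. 1.4.2, §1.6 ¶1 with Rem. 1.3.1, Lemma 1.5.1 (arXiv:1202.6340 p0008 L83–L142, p0011 L33–44, p0007 L125–127, p0009 L127–133)] -/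
theorem prop141_casselsTate_skewPairing_atLevel_printIntended_of_forall_full_hasLevelDecompositionsAt_guarded
    (h : ∀ (p : ℕ) [Fact p.Prime] (K : Type) [Field K] [NumberField K]
      (R : Type) [CommRing R] [IsDomain R] [IsDiscreteValuationRing R] [Algebra ℤ_[p] R]
      (N : ℕ → Type) [∀ k, AddCommGroup (N k)] [∀ k, TopologicalSpace (N k)]
      [∀ k, DiscreteTopology (N k)] [∀ k, Module R (N k)]
      (Rk : ℕ → Type) [∀ k, CommRing (Rk k)] [∀ k, IsLocalRing (Rk k)] [∀ k, TopologicalSpace (Rk k)]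
      [∀ k, DiscreteTopology (Rk k)] [∀ k, Algebra ℤ_[p] (Rk k)] [∀ k, Algebra R (Rk k)]
      [∀ k, Module (Rk k) (N k)] [∀ k, IsScalarTower R (Rk k) (N k)]
      (Nbar : Type) [AddCommGroup Nbar] [TopologicalSpace Nbar] [DiscreteTopology Nbar]
      [∀ k, Module (Rk k) Nbar]
      (Nq : ℕ → Finset (HeightOneSpectrum (𝓞 K)) → Type) [∀ k n, AddCommGroup (Nq k n)]
      [∀ k n, TopologicalSpace (Nq k n)] [∀ k n, DiscreteTopology (Nq k n)]
      [∀ k n, Module (Rk k) (Nq k n)] [∀ k n, Module R (Nq k n)]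
      [∀ k n, IsScalarTower R (Rk k) (Nq k n)]
      (S : DVRSetting p K R N Rk Nbar Nq) (hy : S.SatisfiesH), (∀ i, S.e i = i + 1) →
      ((p : ℕ) : R) ≠ 0 → ¬ p ∣ Nat.card (𝓞 K)ˣ → S.HasLevelDecompositionsAt hy) :
    prop141_casselsTate_skewPairing_atLevel_printIntended := by
  intro p _ K _ _ R _ _ _ _ N _ _ _ _ Rk _ _ _ _ _ _ _ _ Nbar _ _ _ _ Nq _ _ _ _ _ _ S hy hp0 hu k n hn t ht
  let pins : ∀ v : HeightOneSpectrum (𝓞 K), TamePin v := fun v ↦ (nonempty_tamePin v).some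
  letI : ∀ i, TopologicalSpace (S.QuotRing (i + 1)) := fun i ↦ S.refineInstTop i
  haveI : ∀ i, DiscreteTopology (S.QuotRing (i + 1)) := fun i ↦ S.refineInst_discrete i
  haveI : ∀ i, IsLocalRing (S.QuotRing (i + 1)) := fun i ↦ S.refineInst_isLocalRing hy i
  letI : ∀ i, Module (S.QuotRing (i + 1)) Nbar := fun i ↦ S.residualModule hy i
  have hdec : S.HasLevelDecompositionsAt hy :=
    S.hasLevelDecompositionsAt_of_refine hy pins
      (h p K R _ _ Nbar _ (S.refine hy pins) (S.refine_satisfiesH hy pins) (fun _ ↦ rfl) hp0 hu)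
  exact S.skewPairings_display_of_hasLevelDecompositionsAt hy hdec k n hn t ht

/-- **THE TARGET TYPE OF THE CLASS-LEVEL PORT: C45.1″ from `ℤ/p`-valued LEFT-KERNEL tower pairings on FULL settings under the
two printed guards.**  If for every full `DVRSetting` with H.0–H.5, `(p : R) ≠ 0`, `p ∤ #𝓞_K^×`, and every
`(k, n ∈ 𝓝^{(k)}, t + 1 < e_k)` there is a bi-additive `R`-balanced `Q : H¹_{𝓕(n)}(K, T^{(t)}) × H¹_{𝓕(n)}(K, T^{(0)}) → ℤ/p`
with LEFT kernel `= range H¹(red_{t+1→t})`, killing `range H¹(red_{t+1→0})` on the right, and skew — what the cochain-free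
port of Flach's pairing (Morgan–Smith Def. 3.2 at `E = [0 → T̄ → T^{(t+1)} → T^{(t)} → 0]`, read on classes because
`Ш²(K, T̄) = 0`) delivers — then the print-as-intended leaf C45.1″ holds (§1 per full setting, then §2's refinement descent).
[cite: Howard2004HeegnerKolyvagin, Prop. 1.4.1, Thm. 1.4.2 (proof, displays (i)(ii)), §1.6 ¶1, Lemma 1.5.1 (arXiv:1202.6340 p0008 L83–L142, p0011 L33–44, p0009 L127–133)]
[cite: Flach1990, Thm. 1] [cite: MorganSmith2021CTP, Thm. 1.3, Prop. 3.5 and Rem. 6.3] -/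
theorem prop141_casselsTate_skewPairing_atLevel_printIntended_of_forall_full_towerZModLeftKernelPairings
    (h : ∀ (p : ℕ) [Fact p.Prime] (K : Type) [Field K] [NumberField K]
      (R : Type) [CommRing R] [IsDomain R] [IsDiscreteValuationRing R] [Algebra ℤ_[p] R]
      (N : ℕ → Type) [∀ k, AddCommGroup (N k)] [∀ k, TopologicalSpace (N k)]
      [∀ k, DiscreteTopology (N k)] [∀ k, Module R (N k)]
      (Rk : ℕ → Type) [∀ k, CommRing (Rk k)] [∀ k, IsLocalRing (Rk k)] [∀ k, TopologicalSpace (Rk k)]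
      [∀ k, DiscreteTopology (Rk k)] [∀ k, Algebra ℤ_[p] (Rk k)] [∀ k, Algebra R (Rk k)]
      [∀ k, Module (Rk k) (N k)] [∀ k, IsScalarTower R (Rk k) (N k)]
      (Nbar : Type) [AddCommGroup Nbar] [TopologicalSpace Nbar] [DiscreteTopology Nbar]
      [∀ k, Module (Rk k) Nbar]
      (Nq : ℕ → Finset (HeightOneSpectrum (𝓞 K)) → Type) [∀ k n, AddCommGroup (Nq k n)]
      [∀ k n, TopologicalSpace (Nq k n)] [∀ k n, DiscreteTopology (Nq k n)]
      [∀ k n, Module (Rk k) (Nq k n)] [∀ k n, Module R (Nq k n)]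
      [∀ k n, IsScalarTower R (Rk k) (Nq k n)]
      (S : DVRSetting p K R N Rk Nbar Nq) (hy : S.SatisfiesH), (∀ i, S.e i = i + 1) →
      ((p : ℕ) : R) ≠ 0 → ¬ p ∣ Nat.card (𝓞 K)ˣ →
      ∀ (k : ℕ) (n : Finset (HeightOneSpectrum (𝓞 K))), ↑n ⊆ S.levelPrimes k → ∀ (t : ℕ), t + 1 < S.e k →
      ∃ Q : ↥(S.selmerModuleAt hy t n) →+ ↥(S.selmerModuleAt hy 0 n) →+ ZMod p,
        (letI := galoisCohomology.moduleH1 (S.T.ρ t) (S.T.hlin t);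
          letI := galoisCohomology.moduleH1 (S.T.ρ 0) (S.T.hlin 0);
          ∀ (r : R) (a : ↥(S.selmerModuleAt hy t n)) (w : ↥(S.selmerModuleAt hy 0 n)), Q (r • a) w = Q a (r • w)) ∧
        (letI := galoisCohomology.moduleH1 (S.T.ρ t) (S.T.hlin t);
          letI := galoisCohomology.moduleH1 (S.T.ρ (t + 1)) (S.T.hlin (t + 1));
          ∀ a : ↥(S.selmerModuleAt hy t n), (∀ w, Q a w = 0) ↔
            a ∈ LinearMap.range (S.redSelLE hy (Nat.le_succ t) n)) ∧
        (letI := galoisCohomology.moduleH1 (S.T.ρ 0) (S.T.hlin 0);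
          letI := galoisCohomology.moduleH1 (S.T.ρ (t + 1)) (S.T.hlin (t + 1));
          ∀ (z : ↥(S.selmerModuleAt hy (t + 1) n)) (a : ↥(S.selmerModuleAt hy t n)),
            Q a (S.redSelLE hy (Nat.zero_le (t + 1)) n z) = 0) ∧
        (letI := galoisCohomology.moduleH1 (S.T.ρ t) (S.T.hlin t);
          letI := galoisCohomology.moduleH1 (S.T.ρ 0) (S.T.hlin 0);
          ∀ a b : ↥(S.selmerModuleAt hy t n),
            Q a (S.redSelLE hy (Nat.zero_le t) n b) = - Q b (S.redSelLE hy (Nat.zero_le t) n a))) :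
    prop141_casselsTate_skewPairing_atLevel_printIntended :=
  prop141_casselsTate_skewPairing_atLevel_printIntended_of_forall_full_hasLevelDecompositionsAt_guarded
    fun p _ K _ _ R _ _ _ _ N _ _ _ _ Rk _ _ _ _ _ _ _ _ Nbar _ _ _ _ Nq _ _ _ _ _ _ S hy hfull hp0 hu ↦
      S.hasLevelDecompositionsAt_of_towerZModLeftKernelPairings hy hfull (h p K R N Rk Nbar Nq S hy hfull hp0 hu)

end Literature.NumberTheory.GaloisCohomology.Howard2004

end
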